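import Literature.NumberTheory.Automorphic.SymplecticSatakeIsomorphism
import HarnessLib

/-!
# The COUNTING Satake transform of `ℋ(Sp_{2n}(K), Sp_{2n}(𝒪); R)` identifies the Hecke algebra, over EVERY commutative ring `R`
# (no inverse of `q` needed), with the lattice of TWISTED Weyl invariants `f_{w μ} = q^{⟨ρ,μ⟩-⟨ρ,w μ⟩} f_μ`
# (Zhu 2020 §1.4 over `ℤ`; Treumann–Venkatesh 2016 §7.2, the `(W, *)`-action; Gross 1998 (3.10)–(3.11); Cartier 1979 §IV Thm. 4.1)

Topic `NumberTheory/Automorphic`; namespace `Literature.NumberTheory.Automorphic.SymplecticCartan` (lane `lit-hodgefound`,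
Track 2 foundations; seat `lit-hodgefound-p11`, generation 50, row g50-#8).  Two DEFINITIONS with bodies (`symplecticTwistedTarget`,
an `R`-submodule of `R[ℤⁿ]`; `symplecticCountingSatakeLinearEquiv`) + theorems; no named fact, no instance, no notation.  The
`Sp_{2n}` analogue of `HyperspecialUnitarySatakeCountingImage` (g49-#6), on top of the `W(C_n)`-invariance of `𝒮_q` (g50-#5).

## The mathematics

`G = Sp_{2n}(K)`, `K₀ = Sp_{2n}(𝒪)` (compact `𝒪`, residue cardinality `q`), `a(γ) ∈ ℤⁿ` the Iwasawa exponents, `W = W(C_n)` the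
signed permutations, `⟨ρ, μ⟩ = Σ_i (n-i) μ_i`.  The COUNTING transform `𝒮_1(T) = Σ_μ #{γ ∈ T : a γ = μ} x^μ` (weight `1`; the
tree's `symplecticSatakeTransform hϖ 1`) is defined over `ℤ` and injective over every commutative `R`; Cartier's transform is
`𝒮_q = monomialTwist(q^{⟨ρ,·⟩}) ∘ 𝒮_1` and is `W`-invariant where `q` is a unit (g50-#5).  [TreumannVenkatesh2016] §7.2:
`𝒮^* = δ^{-1/2} 𝒮` (`= 𝒮_1`) maps onto the invariants of the TWISTED action `w * x^μ = q^{⟨ρ,μ⟩-⟨ρ,wμ⟩} x^{w μ}`; clearing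
denominators gives an image description valid over EVERY `R`:

  `𝒯_R = {f ∈ R[ℤⁿ] : f_{w μ} = q^{⟨ρ,μ⟩-⟨ρ,wμ⟩} · f_μ for all w ∈ W and μ with ⟨ρ,wμ⟩ ≤ ⟨ρ,μ⟩}`   (`symplecticTwistedTarget R n q`)

(each pair is constrained once, from its MORE dominant end, with a non-negative power of `q`).  THEOREM: **for every commutative
ring `R`, `𝒮_1 : ℋ(Sp_{2n}(K), K₀; R) ⥲ 𝒯_R` is an isomorphism of `R`-modules** — over `ℤ` this is [ZhuIntegralSatake2020] §1.4
(`CT^{cl} : H_G ⥲ ℤ[X^*(T̂)] ∩ ℚ[X^*(T̂)]^{(W,•_ρ)}`, `w •_ρ e^λ = q^{⟨ρ, wλ-λ⟩} e^{wλ}`) and Gross (3.10)–(3.11) (`S(c_λ) = φ_λ +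
Σ_{μ<λ} b_λ(μ) φ_μ`, `b_λ(μ) ∈ ℤ`, `φ_λ = q^{⟨λ,ρ⟩} χ_λ`); over `ℤ[q⁻¹]` and fields it is [TreumannVenkatesh2016] §7.2 Thm. (i); over
`𝔽_p`, `p ∣ q`, `𝒯_{𝔽_p}` is the space of functions supported on the `⟨ρ,·⟩`-maximal element of each `W`-orbit (Herzig's mod-`p`
Satake isomorphism, trivial weight; `mem_symplecticTwistedTarget_iff_of_cast_eq_zero`).  CONVENTION: the tree's exponents `a(γ)`
(`symplecticIwasawaExp`) put the coefficient `1` of `𝒮_1(T_{d(a)})` at the DOMINANT `a` (Bruhat–Tits (4.4.4) (ii)), so powers of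
`q` grow towards the less dominant end; Zhu/Herzig index by `λ` with `g ∈ λ(ϖ)UK`, coefficient `1` at the ANTIdominant end — the two
descriptions correspond under `x^μ ↦ x^{-μ}` (and `-1 ∈ W(C_n)`).  The extension from `ℤ`, `ℤ[q⁻¹]`, `𝔽_p` to an arbitrary
coefficient ring `R` is the same triangular argument, run directly over `R` (no base change).
PROOF.  (⊆) The coefficients of `𝒮_1(T_g)` are the natural numbers `n_g(μ) = #{γ ⊆ K₀gK₀ : a γ = μ}`; the `W`-invariance of
`𝒮_q(T_g)` over `ℚ` (g50-#5 with `q ∈ ℚˣ`) reads `n_g(wμ) q^{⟨ρ,wμ⟩} = n_g(μ) q^{⟨ρ,μ⟩}`, an identity of natural numbers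
`n_g(wμ) = q^{⟨ρ,μ⟩-⟨ρ,wμ⟩} n_g(μ)` that maps to every `R`; the `T_g` span `ℋ_R`.  (⊇) Cartier's triangular induction from the
DOMINANT end, where no division occurs: for `0 ≠ f ∈ 𝒯_R` let `a ∈ supp f` maximise the head-sum vector lexicographically; the
relations force `supp f` to be stable under the `W`-moves that do not decrease `⟨ρ, ·⟩`, and a transposition at an ascent or a sign
flip at a negative coordinate both increase `⟨ρ,·⟩` and the head sums, so `a` is dominant (`antitone_nonneg_of_isMaxOn_of_mem_twisted`);
the counting transform of the Cartan operator `T_{d(a)}` has coefficient EXACTLY `1` at `x^a` (Bruhat–Tits (4.4.4) (ii)) and support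
dominated by `a`, so `f - f_a 𝒮_1(T_{d(a)}) ∈ 𝒯_R` has a strictly smaller set `U(f)`; induct.

## What is formalised

* §1 `symplecticTwistedTarget R n b`, `mem_symplecticTwistedTarget_iff`, `signedPerm_inv_apply` (bookkeeping),
  **`coeff_ne_zero_signedPerm_of_mem_twisted`** (support stability), `mem_symplecticTwistedTarget_iff_of_cast_eq_zero` (`q = 0` in `R`).
* §2 `symplecticRhoPairing_comp_swap_sub` (`⟨ρ, μ∘(i j)⟩ - ⟨ρ,μ⟩ = (j-i)(μ_j-μ_i)`… as `(ρ_i-ρ_j)(μ_j-μ_i)`), `symplecticRhoPairing_signFlip_sub`,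
  **`antitone_nonneg_of_isMaxOn_of_mem_twisted`**.
* §3 **`card_filter_symplecticIwasawaExp_signedPerm_eq`** (`n_g(wμ) = q^{⟨ρ,μ⟩-⟨ρ,wμ⟩} n_g(μ)` in `ℕ`),
  **`symplecticSatakeTransform_one_mem_twisted`** (`𝒮_1(T) ∈ 𝒯_R`, every `R`).
* §4 `twistedDominantBelow`, `finite_twistedDominantBelow`, **`exists_symplecticSatakeTransform_one_eq_of_mem_twisted`** (SURJECTIVITY),
  **`range_symplecticSatakeTransform_one_eq_twisted`**, **`symplecticCountingSatakeLinearEquiv : ℋ_R ≃ₗ[R] 𝒯_R`**, `…_apply`.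
* §5 **`mem_symplecticTwistedTarget_iff_monomialTwist_mem_weylInvariants`** (`𝒯_R = twist⁻¹(R[ℤⁿ]^W)` when `q ∈ Rˣ`),
  `monomialTwist_symplecticCountingSatakeLinearEquiv` (`twist ∘ 𝒮_1 = 𝒮_q = symplecticSatakeAlgEquiv`).

## References
* [ZhuIntegralSatake2020] X. Zhu, *A note on integral Satake isomorphisms*, arXiv:2005.13056 (2020), §1.4 (the classical Satake
  transform over `ℤ`: `CT^{cl} : H_G ⥲ ℤ[X^*(T̂)^σ] ∩ ℚ[X^*(T̂)^σ]^{W_0 •_ρ}`; the twisted orbit sums `Σ_{λ'∈W λ} q^{⟨ρ,λ'-λ⟩} e^{λ'}`).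
* [TreumannVenkatesh2016] D. Treumann, A. Venkatesh, *Functoriality, Smith theory, and the Brauer homomorphism*, Ann. of Math. 183
  (2016), §7.2 (the twisted `W`-action, `𝒮^* = δ^{-1/2} 𝒮`, Theorem (i)).
* [GrossSatake1998] B. H. Gross, *On the Satake isomorphism*, LMS Lecture Notes 254 (1998), (3.8)–(3.11), Prop. 3.6.
* [Herzig2010] F. Herzig, *A Satake isomorphism in characteristic p*, Compos. Math. 147 (2011), Thm. 1.2.
* [CartierCorvallis1979] P. Cartier, *Representations of 𝔭-adic groups: a survey*, PSPM 33.1 (1979), §IV (4.2), Thm. 4.1.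
* [BruhatTits1972] F. Bruhat, J. Tits, *Groupes réductifs sur un corps local I*, Publ. Math. IHÉS 41 (1972), (4.4.3), (4.4.4).
-/

noncomputable section

open scoped Valued WithZero MatrixGroups
open Matrix MonoidAlgebra Representation

namespace Literature.NumberTheory.Automorphic.SymplecticCartan

open Literature.NumberTheory.Automorphic Literature.NumberTheory.Automorphic.CartanUnique
  Literature.NumberTheory.Automorphic.HermitianLattice

variable {R : Type*} [CommRing R] {n : ℕ}

/-! ## §1 The twisted invariants `𝒯_R` -/

variable (R n) in
/-- **`𝒯_R ⊆ R[ℤⁿ]`, the twisted `W(C_n)`-invariants**: `f_{wμ} = b^{⟨ρ,μ⟩-⟨ρ,wμ⟩} f_μ` for every signed permutation `w = (ε, π)`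
and every `μ` with `⟨ρ, wμ⟩ ≤ ⟨ρ, μ⟩` (`b` = the residue cardinality).  An `R`-submodule (in fact the image of the counting
transform, a subalgebra). [cite: TreumannVenkatesh2016, §7.2] [cite: ZhuIntegralSatake2020, §1.4] [cite: GrossSatake1998, (3.10)–(3.11)] -/
def symplecticTwistedTarget (b : ℕ) : Submodule R (AddMonoidAlgebra R (Fin n → ℤ)) where
  carrier := {f | ∀ (μ : Fin n → ℤ) (ε : Fin n → ℤˣ) (π : Equiv.Perm (Fin n)),
    symplecticRhoPairing (fun i => (ε i : ℤ) * μ (π i)) ≤ symplecticRhoPairing μ →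
      f.coeff (fun i => (ε i : ℤ) * μ (π i)) =
        (b : R) ^ (symplecticRhoPairing μ - symplecticRhoPairing (fun i => (ε i : ℤ) * μ (π i))).toNat * f.coeff μ}
  add_mem' {f g} hf hg μ ε π h := by
    rw [AddMonoidAlgebra.coeff_add, Finsupp.add_apply, Finsupp.add_apply, hf μ ε π h, hg μ ε π h, mul_add]
  zero_mem' μ ε π h := by simp
  smul_mem' c f hf μ ε π h := by
    rw [AddMonoidAlgebra.coeff_smul, Finsupp.smul_apply, Finsupp.smul_apply, hf μ ε π h, smul_eq_mul, smul_eq_mul, mul_left_comm]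

/-- Membership in `𝒯_R`. [cite: TreumannVenkatesh2016, §7.2] -/
theorem mem_symplecticTwistedTarget_iff (b : ℕ) (f : AddMonoidAlgebra R (Fin n → ℤ)) :
    f ∈ symplecticTwistedTarget R n b ↔ ∀ (μ : Fin n → ℤ) (ε : Fin n → ℤˣ) (π : Equiv.Perm (Fin n)),
      symplecticRhoPairing (fun i => (ε i : ℤ) * μ (π i)) ≤ symplecticRhoPairing μ →
        f.coeff (fun i => (ε i : ℤ) * μ (π i)) =
          (b : R) ^ (symplecticRhoPairing μ - symplecticRhoPairing (fun i => (ε i : ℤ) * μ (π i))).toNat * f.coeff μ :=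
  Iff.rfl

/-- **Inverting a signed permutation**: `μ = ((ε_{π⁻¹ j} (wμ)_{π⁻¹ j})_j` for `wμ = (ε_i μ_{π i})_i`. [cite: Satake1963, §7] -/
theorem signedPerm_inv_apply (ε : Fin n → ℤˣ) (π : Equiv.Perm (Fin n)) (μ : Fin n → ℤ) :
    (fun j => (ε (π.symm j) : ℤ) * (fun i => (ε i : ℤ) * μ (π i)) (π.symm j)) = μ := by
  funext j
  simp only []
  rw [← mul_assoc, ← Units.val_mul, Int.units_mul_self, Units.val_one, one_mul, Equiv.apply_symm_apply]

/-- **Support stability**: for `f ∈ 𝒯_R` with `f_μ ≠ 0`, every `wμ` with `⟨ρ, μ⟩ ≤ ⟨ρ, wμ⟩` lies in the support too (the relation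
read from the more dominant end `wμ`). [cite: TreumannVenkatesh2016, §7.2] -/
theorem coeff_ne_zero_signedPerm_of_mem_twisted {b : ℕ} {f : AddMonoidAlgebra R (Fin n → ℤ)} (hf : f ∈ symplecticTwistedTarget R n b)
    {μ : Fin n → ℤ} (hμ : f.coeff μ ≠ 0) (ε : Fin n → ℤˣ) (π : Equiv.Perm (Fin n))
    (hρ : symplecticRhoPairing μ ≤ symplecticRhoPairing (fun i => (ε i : ℤ) * μ (π i))) :
    f.coeff (fun i => (ε i : ℤ) * μ (π i)) ≠ 0 := by
  intro h0
  have h := hf (fun i => (ε i : ℤ) * μ (π i)) (fun j => ε (π.symm j)) π.symm (by rw [signedPerm_inv_apply]; exact hρ)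
  rw [signedPerm_inv_apply, h0, mul_zero] at h
  exact hμ h

/-- **`𝒯_R` when `q = 0` in `R`** (e.g. `R = 𝔽_p`, `p ∣ q`): `f_{wμ} = 0` if `⟨ρ,wμ⟩ < ⟨ρ,μ⟩` and `f_{wμ} = f_μ` if `⟨ρ,wμ⟩ = ⟨ρ,μ⟩` —
the functions supported on the `⟨ρ,·⟩`-maximal (= dominant) cocharacter of each `W`-orbit (Herzig's mod-`p` Satake image for
trivial weight; antidominant in Herzig's convention `ord_F ∘ α ≤ 0`, dominant for the tree's exponents `a(γ)`). [cite: Herzig2010, Thm. 1.2, Cor. 1.3]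
[cite: TreumannVenkatesh2016, §7.2] -/
theorem mem_symplecticTwistedTarget_iff_of_cast_eq_zero {b : ℕ} (hb : (b : R) = 0) (f : AddMonoidAlgebra R (Fin n → ℤ)) :
    f ∈ symplecticTwistedTarget R n b ↔ ∀ (μ : Fin n → ℤ) (ε : Fin n → ℤˣ) (π : Equiv.Perm (Fin n)),
      (symplecticRhoPairing (fun i => (ε i : ℤ) * μ (π i)) < symplecticRhoPairing μ → f.coeff (fun i => (ε i : ℤ) * μ (π i)) = 0) ∧
      (symplecticRhoPairing (fun i => (ε i : ℤ) * μ (π i)) = symplecticRhoPairing μ →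
        f.coeff (fun i => (ε i : ℤ) * μ (π i)) = f.coeff μ) := by
  rw [mem_symplecticTwistedTarget_iff]
  refine ⟨fun h μ ε π => ⟨fun hlt => ?_, fun heq => ?_⟩, fun h μ ε π hle => ?_⟩
  · rw [h μ ε π hlt.le, hb, zero_pow (by omega), zero_mul]
  · rw [h μ ε π heq.le, heq, sub_self, Int.toNat_zero, pow_zero, one_mul]
  · rcases hle.lt_or_eq with hlt | heq
    · rw [(h μ ε π).1 hlt, hb, zero_pow (by omega), zero_mul]
    · rw [(h μ ε π).2 heq, heq, sub_self, Int.toNat_zero, pow_zero, one_mul]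

/-! ## §2 A head-sum maximal element of the support of `f ∈ 𝒯_R` is dominant -/

/-- `⟨ρ, μ ∘ (i j)⟩ - ⟨ρ, μ⟩ = (j - i)(μ_j - μ_i)` … precisely `(ρ_i - ρ_j)(μ_j - μ_i)` with `ρ_i = n - i`. [cite: TreumannVenkatesh2016, §7.2] -/
theorem symplecticRhoPairing_comp_swap_sub (μ : Fin n → ℤ) {i j : Fin n} (hij : i ≠ j) :
    symplecticRhoPairing (μ ∘ Equiv.swap i j) - symplecticRhoPairing μ = (((j : ℕ) : ℤ) - (i : ℕ)) * (μ j - μ i) := by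
  classical
  rw [symplecticRhoPairing, symplecticRhoPairing, ← Finset.sum_sub_distrib]
  rw [Finset.sum_eq_add_of_mem i j (Finset.mem_univ _) (Finset.mem_univ _) hij fun k _ hk => ?_]
  · rw [Function.comp_apply, Function.comp_apply, Equiv.swap_apply_left, Equiv.swap_apply_right]
    ring
  · rw [Function.comp_apply, Equiv.swap_apply_of_ne_of_ne hk.1 hk.2, sub_self]

/-- `⟨ρ, μ'⟩ - ⟨ρ, μ⟩ = -2(n-k) μ_k` for the sign flip `μ'` of `μ` at `k`. [cite: TreumannVenkatesh2016, §7.2] -/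
theorem symplecticRhoPairing_signFlip_sub (μ : Fin n → ℤ) (k : Fin n) :
    symplecticRhoPairing (fun i => (signFlipAt k i : ℤ) * μ i) - symplecticRhoPairing μ = -2 * ((n : ℤ) - (k : ℕ)) * μ k := by
  classical
  rw [symplecticRhoPairing, symplecticRhoPairing, ← Finset.sum_sub_distrib,
    Finset.sum_eq_single_of_mem k (Finset.mem_univ _) fun i _ hi => ?_]
  · rw [signFlipAt_self, Units.val_neg, Units.val_one]
    ring
  · rw [signFlipAt_of_ne hi, Units.val_one, one_mul, sub_self]

/-- **A head-sum lexicographically maximal element of `supp f`, `f ∈ 𝒯_R`, is dominant** (antitone and `≥ 0`): a transposition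
at an ascent, or a sign flip at a negative coordinate, increases both `⟨ρ,·⟩` (so stays in the support) and the head-sum vector.
[cite: CartierCorvallis1979, §IV, proof of Thm. 4.1 (c)] [cite: TreumannVenkatesh2016, §7.2] -/
theorem antitone_nonneg_of_isMaxOn_of_mem_twisted {b : ℕ} {f : AddMonoidAlgebra R (Fin n → ℤ)} (hf : f ∈ symplecticTwistedTarget R n b)
    {a : Fin n → ℤ} (ha : f.coeff a ≠ 0) (hmax : ∀ μ, f.coeff μ ≠ 0 → toLex (headSumVec μ) ≤ toLex (headSumVec a)) :
    Antitone a ∧ ∀ i, 0 ≤ a i := by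
  constructor
  · intro i j hij
    by_contra hcon
    rw [not_le] at hcon
    have hne : i ≠ j := fun h => by rw [h] at hcon; exact lt_irrefl _ hcon
    have hlt : (i : ℕ) < (j : ℕ) := lt_of_le_of_ne (Fin.le_iff_val_le_val.1 hij) fun h => hne (Fin.ext h)
    -- the swapped vector lies in the support
    have hb : f.coeff (a ∘ Equiv.swap i j) ≠ 0 := by
      have h := coeff_ne_zero_signedPerm_of_mem_twisted hf ha (fun _ => 1) (Equiv.swap i j) (by
        have hs := symplecticRhoPairing_comp_swap_sub a hne
        have h1 : (fun k => ((1 : ℤˣ) : ℤ) * a (Equiv.swap i j k)) = a ∘ Equiv.swap i j := by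
          funext k; rw [Units.val_one, one_mul, Function.comp_apply]
        rw [h1]
        have : 0 ≤ (((j : ℕ) : ℤ) - (i : ℕ)) * (a j - a i) := mul_nonneg (by omega) (by omega)
        omega)
      have h1 : (fun k => ((1 : ℤˣ) : ℤ) * a (Equiv.swap i j k)) = a ∘ Equiv.swap i j := by
        funext k; rw [Units.val_one, one_mul, Function.comp_apply]
      rwa [h1] at h
    refine absurd (hmax _ hb) (not_le.2 (toLex_headSumVec_lt i (fun r hr => ?_) ?_))
    · exact (headSum_comp_eq_of_forall_lt a _ r fun k hk =>
        Equiv.swap_apply_of_ne_of_ne (fun h => by rw [h] at hk; omega) (fun h => by rw [h] at hk; omega)).symm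
    · rw [headSum_succ, headSum_succ, headSum_comp_eq_of_forall_lt a _ _ fun k hk =>
        Equiv.swap_apply_of_ne_of_ne (fun h => by rw [h] at hk; omega) (fun h => by rw [h] at hk; omega),
        Function.comp_apply, Equiv.swap_apply_left]
      omega
  · intro k
    by_contra hcon
    rw [not_le] at hcon
    have hb : f.coeff (fun i => (signFlipAt k i : ℤ) * a i) ≠ 0 := by
      have h := coeff_ne_zero_signedPerm_of_mem_twisted hf ha (signFlipAt k) 1 (by
        simp only [Equiv.Perm.coe_one, id_eq]
        have hs := symplecticRhoPairing_signFlip_sub a k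
        have hk := k.isLt
        have : 0 < -2 * ((n : ℤ) - (k : ℕ)) * a k := by nlinarith
        omega)
      simpa only [Equiv.Perm.coe_one, id_eq] using h
    refine absurd (hmax _ hb) (not_le.2 (toLex_headSumVec_lt k (fun r hr => ?_) ?_))
    · refine (Finset.sum_congr rfl fun i _ => ?_).symm
      split_ifs with hi
      · have hik : i ≠ k := fun h => by rw [h] at hi; omega
        change (signFlipAt k i : ℤ) * a i = a i
        rw [signFlipAt_of_ne hik, Units.val_one, one_mul]
      · rfl
    · rw [headSum_succ, headSum_succ]
      rw [signFlipAt_self, Units.val_neg, Units.val_one, neg_one_mul]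
      have heq : headSum (fun i => (signFlipAt k i : ℤ) * a i) k = headSum a k := by
        refine Finset.sum_congr rfl fun i _ => ?_
        split_ifs with hi
        · have hik : i ≠ k := fun h => by rw [h] at hi; omega
          change (signFlipAt k i : ℤ) * a i = a i
          rw [signFlipAt_of_ne hik, Units.val_one, one_mul]
        · rfl
      rw [heq]
      omega

/-! ## §3 The counting transform lands in `𝒯_R` -/

section Image

variable {K : Type*} [Field K] [Valued K ℤᵐ⁰] {ϖ : K} [CompactSpace 𝒪[K]] [Finite 𝓀[K]]

/-- **`n_g(wμ) = q^{⟨ρ,μ⟩-⟨ρ,wμ⟩} · n_g(μ)` in `ℕ`** for `⟨ρ,wμ⟩ ≤ ⟨ρ,μ⟩`, where `n_g(μ) = #{γ ⊆ K₀gK₀ : a γ = μ}`: the `W`-invariance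
of `𝒮_q(T_g)` over `ℚ` with the coefficient formula `𝒮_q(T_g)_μ = n_g(μ) q^{⟨ρ,μ⟩}`. [cite: TreumannVenkatesh2016, §7.2]
[cite: CartierCorvallis1979, §IV (4.2), Thm. 4.1 (b)] -/
theorem card_filter_symplecticIwasawaExp_signedPerm_eq (hϖ : Valued.v ϖ = WithZero.exp (-1 : ℤ)) (g : symplecticGroup (Fin n) K)
    (μ : Fin n → ℤ) (ε : Fin n → ℤˣ) (π : Equiv.Perm (Fin n))
    (hρ : symplecticRhoPairing (fun i => (ε i : ℤ) * μ (π i)) ≤ symplecticRhoPairing μ)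
    [IsHeckeTriple (⊤ : Submonoid (symplecticGroup (Fin n) K)) (symplecticInt (Fin n) K) (symplecticInt (Fin n) K)]
    [DecidablePred fun α : symplecticGroup (Fin n) K ⧸ symplecticInt (Fin n) K => symplecticIwasawaExp hϖ α.out = fun i => (ε i : ℤ) * μ (π i)]
    [DecidablePred fun α : symplecticGroup (Fin n) K ⧸ symplecticInt (Fin n) K => symplecticIwasawaExp hϖ α.out = μ] :
    ((finite_orbit_quotient (symplecticInt (Fin n) K) g).toFinset.filter
        fun α => symplecticIwasawaExp hϖ α.out = fun i => (ε i : ℤ) * μ (π i)).card =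
      Nat.card 𝓀[K] ^ (symplecticRhoPairing μ - symplecticRhoPairing (fun i => (ε i : ℤ) * μ (π i))).toNat *
        ((finite_orbit_quotient (symplecticInt (Fin n) K) g).toFinset.filter fun α => symplecticIwasawaExp hϖ α.out = μ).card := by
  classical
  have hb : (Nat.card 𝓀[K] : ℚ) ≠ 0 := Nat.cast_ne_zero.2 Nat.card_pos.ne'
  set q : ℚˣ := Units.mk0 (Nat.card 𝓀[K] : ℚ) hb with hq
  have hq' : (q : ℚ) = Nat.card 𝓀[K] := rfl
  have hW := coeff_symplecticSatakeTransform_signedPerm (R := ℚ) hϖ q hq'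
    (heckeAlgebra.doubleCosetOperator (symplecticInt (Fin n) K) g) ε π μ
  rw [coeff_symplecticSatakeTransform_doubleCosetOperator, coeff_symplecticSatakeTransform_doubleCosetOperator] at hW
  set d := (symplecticRhoPairing μ - symplecticRhoPairing (fun i => (ε i : ℤ) * μ (π i))).toNat with hd
  have hsplit : symplecticRhoPairing μ = symplecticRhoPairing (fun i => (ε i : ℤ) * μ (π i)) + (d : ℤ) := by
    rw [hd, Int.toNat_of_nonneg (by omega)]; ring
  rw [hsplit, _root_.zpow_add, zpow_natCast, Units.val_mul, ← mul_assoc] at hW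
  have hu : ((q ^ symplecticRhoPairing (fun i => (ε i : ℤ) * μ (π i)) : ℚˣ) : ℚ) ≠ 0 := Units.ne_zero _
  have hW' : ((((finite_orbit_quotient (symplecticInt (Fin n) K) g).toFinset.filter
        fun α => symplecticIwasawaExp hϖ α.out = fun i => (ε i : ℤ) * μ (π i)).card : ℕ) : ℚ) =
      ((((finite_orbit_quotient (symplecticInt (Fin n) K) g).toFinset.filter
        fun α => symplecticIwasawaExp hϖ α.out = μ).card : ℕ) : ℚ) * ((q ^ d : ℚˣ) : ℚ) :=
    mul_right_cancel₀ hu (by rw [hW, mul_right_comm])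
  rw [Units.val_pow_eq_pow_val, hq', mul_comm] at hW'
  exact_mod_cast hW'

/-- **`𝒮_1(T) ∈ 𝒯_R` for every `T ∈ ℋ_R(Sp_{2n}(K), Sp_{2n}(𝒪))` and every commutative ring `R`** (from the double-coset operators,
whose counting coefficients are natural numbers, by linearity). [cite: TreumannVenkatesh2016, §7.2 Theorem (i)] [cite: ZhuIntegralSatake2020, §1.4]
[cite: GrossSatake1998, (3.10)–(3.11)] -/
theorem symplecticSatakeTransform_one_mem_twisted (hϖ : Valued.v ϖ = WithZero.exp (-1 : ℤ))
    (T : heckeAlgebra R (symplecticGroup (Fin n) K) (symplecticInt (Fin n) K)) :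
    symplecticSatakeTransform hϖ 1 T ∈ symplecticTwistedTarget R n (Nat.card 𝓀[K]) := by
  classical
  haveI := isHeckeTriple_symplecticInt (K := K) (l := Fin n)
  have hT := heckeAlgebra.mem_span_range_doubleCosetOperator (symplecticInt (Fin n) K) T
  induction hT using Submodule.span_induction with
  | mem S hS =>
    obtain ⟨g, rfl⟩ := hS
    intro μ ε π hρ
    rw [coeff_symplecticSatakeTransform_doubleCosetOperator, coeff_symplecticSatakeTransform_doubleCosetOperator, _root_.one_zpow,
      _root_.one_zpow,
      Units.val_one, mul_one, mul_one, card_filter_symplecticIwasawaExp_signedPerm_eq hϖ g μ ε π hρ, Nat.cast_mul, Nat.cast_pow]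
  | zero => exact Submodule.zero_mem _
  | add S S' _ _ hS hS' => rw [map_add]; exact Submodule.add_mem _ hS hS'
  | smul c S _ hS => rw [map_smul]; exact Submodule.smul_mem _ c hS

end Image

/-! ## §4 Surjectivity onto `𝒯_R` and the counting Satake isomorphism over every `R` -/

section Surjective

/-- `U(f)`: the dominant exponents below some dominant exponent of `supp f`. [cite: CartierCorvallis1979, §IV, proof of Thm. 4.1 (c)] -/
def twistedDominantBelow (f : AddMonoidAlgebra R (Fin n → ℤ)) : Set (Fin n → ℤ) :=
  {la | Antitone la ∧ (∀ i, 0 ≤ la i) ∧ ∃ b : Fin n → ℤ, f.coeff b ≠ 0 ∧ Antitone b ∧ ∀ r, headSum la r ≤ headSum b r}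

/-- `U(f)` is finite. [cite: CartierCorvallis1979, §IV, proof of Thm. 4.1 (c)] -/
theorem finite_twistedDominantBelow (f : AddMonoidAlgebra R (Fin n → ℤ)) : (twistedDominantBelow f).Finite := by
  refine Set.Finite.subset (Set.Finite.biUnion (Finset.finite_toSet f.coeff.support)
    fun b _ => finite_setOf_antitone_nonneg_headSum_le b) ?_
  rintro la ⟨h1, h2, b, hb, -, hle⟩
  exact Set.mem_biUnion (Finsupp.mem_support_iff.2 hb) ⟨h1, h2, hle⟩

variable {K : Type*} [Field K] [Valued K ℤᵐ⁰] {ϖ : K} [CompactSpace 𝒪[K]] [Finite 𝓀[K]]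

/-- **SURJECTIVITY OF THE COUNTING TRANSFORM ONTO `𝒯_R`, EVERY COMMUTATIVE `R`** (Cartier's triangular induction from the dominant
end: the counting transform of `T_{d(a)}` has coefficient exactly `1` at `x^a`, so no division is needed).
[cite: ZhuIntegralSatake2020, §1.4] [cite: TreumannVenkatesh2016, §7.2 Theorem (i)] [cite: GrossSatake1998, (3.10)–(3.11)]
[cite: CartierCorvallis1979, §IV Thm. 4.1, proof (c)] -/
theorem exists_symplecticSatakeTransform_one_eq_of_mem_twisted (hϖ : Valued.v ϖ = WithZero.exp (-1 : ℤ))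
    (f : AddMonoidAlgebra R (Fin n → ℤ)) (hf : f ∈ symplecticTwistedTarget R n (Nat.card 𝓀[K])) :
    ∃ T : heckeAlgebra R (symplecticGroup (Fin n) K) (symplecticInt (Fin n) K), symplecticSatakeTransform hϖ 1 T = f := by
  classical
  haveI := isHeckeTriple_symplecticInt (K := K) (l := Fin n)
  suffices H : ∀ (m : ℕ) (f : AddMonoidAlgebra R (Fin n → ℤ)), f ∈ symplecticTwistedTarget R n (Nat.card 𝓀[K]) →
      (finite_twistedDominantBelow f).toFinset.card = m →
      ∃ T : heckeAlgebra R (symplecticGroup (Fin n) K) (symplecticInt (Fin n) K), symplecticSatakeTransform hϖ 1 T = f from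
    H _ f hf rfl
  intro m
  induction m using Nat.strong_induction_on with
  | _ m ih =>
  intro f hf hm
  by_cases h0 : f = 0
  · exact ⟨0, by rw [h0, map_zero]⟩
  have hSne : f.coeff.support.Nonempty := by
    rw [Finsupp.support_nonempty_iff, ne_eq, AddMonoidAlgebra.coeff_eq_zero]
    exact h0
  obtain ⟨a, haS, hmax⟩ := f.coeff.support.exists_max_image (fun μ => toLex (headSumVec μ)) hSne
  have haS' : f.coeff a ≠ 0 := Finsupp.mem_support_iff.1 haS
  obtain ⟨hmono, hnn⟩ := antitone_nonneg_of_isMaxOn_of_mem_twisted hf haS' fun μ hμ => hmax μ (Finsupp.mem_support_iff.2 hμ)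
  have hmonoN : Antitone (fun i => (a i).toNat) := fun _ _ hij => Int.toNat_le_toNat (hmono hij)
  have haN : (fun i => ((a i).toNat : ℤ)) = a := funext fun i => Int.toNat_of_nonneg (hnn i)
  -- the Cartan operator `T_{d(a)}` and its counting transform `F = x^a + lower terms`
  set Ta : heckeAlgebra R (symplecticGroup (Fin n) K) (symplecticInt (Fin n) K) :=
    heckeAlgebra.doubleCosetOperator (symplecticInt (Fin n) K)
      (⟨Matrix.diagonal (Sum.elim (fun i => ϖ ^ (a i).toNat) (fun i => (ϖ ^ (a i).toNat)⁻¹)),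
        diagonal_pow_mem_symplecticGroup (CartanUnique.uniformizer_ne_zero hϖ) fun i => (a i).toNat⟩ : symplecticGroup (Fin n) K)
    with hTa
  set F := symplecticSatakeTransform hϖ 1 Ta with hFdef
  have hcF : F.coeff a = 1 := by
    have h := coeff_self_symplecticSatakeTransform_cartanDiagonal hϖ (1 : Rˣ) hmonoN
    rw [haN, _root_.one_zpow, Units.val_one] at h
    exact h
  have htri : ∀ μ, F.coeff μ ≠ 0 → ∀ r, headSum μ r ≤ headSum a r := fun μ hμ r => by
    have h := headSum_le_of_coeff_symplecticSatakeTransform_ne_zero hϖ 1 hmonoN hμ r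
    rw [headSum_eq, headSum_eq]
    refine h.trans (le_of_eq (Finset.sum_congr rfl fun i _ => ?_))
    rw [Int.toNat_of_nonneg (hnn i)]
  have hF : F ∈ symplecticTwistedTarget R n (Nat.card 𝓀[K]) := symplecticSatakeTransform_one_mem_twisted hϖ Ta
  -- `g = f - f_a F`
  set k : R := f.coeff a with hk
  set g := f - k • F with hgdef
  have hg : g ∈ symplecticTwistedTarget R n (Nat.card 𝓀[K]) := Submodule.sub_mem _ hf (Submodule.smul_mem _ k hF)
  have hgcoeff : ∀ μ, g.coeff μ = f.coeff μ - k * F.coeff μ := fun μ => by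
    rw [hgdef, AddMonoidAlgebra.coeff_sub, AddMonoidAlgebra.coeff_smul, Finsupp.sub_apply, Finsupp.smul_apply, smul_eq_mul]
  have hga : g.coeff a = 0 := by rw [hgcoeff, hk, hcF, mul_one, sub_self]
  have hgsupp : ∀ μ, g.coeff μ ≠ 0 → f.coeff μ ≠ 0 ∨ F.coeff μ ≠ 0 := fun μ h => by
    by_contra h'
    rw [not_or, not_ne_iff, not_ne_iff] at h'
    exact h (by rw [hgcoeff, h'.1, h'.2, mul_zero, sub_zero])
  have hsub : twistedDominantBelow g ⊆ twistedDominantBelow f := by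
    rintro la ⟨h1, h2, b, hb, hbm, hle⟩
    rcases hgsupp b hb with hbf | hbF
    · exact ⟨h1, h2, b, hbf, hbm, hle⟩
    · exact ⟨h1, h2, a, haS', hmono, fun r => (hle r).trans (htri b hbF r)⟩
  have haU : a ∈ twistedDominantBelow f := ⟨hmono, hnn, a, haS', hmono, fun _ => le_rfl⟩
  have haU' : a ∉ twistedDominantBelow g := by
    rintro ⟨-, -, b, hb, -, hle⟩
    have hba : a = b := by
      rcases hgsupp b hb with hbf | hbF
      · exact eq_of_headSum_le_of_toLex_le hle (hmax b (Finsupp.mem_support_iff.2 hbf))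
      · exact eq_of_headSum_le_antisymm hle (htri b hbF)
    rw [← hba] at hb
    exact hb hga
  have hlt : (finite_twistedDominantBelow g).toFinset.card < (finite_twistedDominantBelow f).toFinset.card :=
    Finset.card_lt_card (Set.Finite.toFinset_ssubset_toFinset.2 ((Set.ssubset_iff_of_subset hsub).2 ⟨a, haU, haU'⟩))
  obtain ⟨T', hT'⟩ := ih _ (hm ▸ hlt) g hg rfl
  refine ⟨T' + k • Ta, ?_⟩
  rw [map_add, map_smul, hT', hgdef, sub_add_cancel]

/-- **`range 𝒮_1 = 𝒯_R`.** [cite: ZhuIntegralSatake2020, §1.4] [cite: TreumannVenkatesh2016, §7.2 Theorem (i)] [cite: GrossSatake1998, (3.10)–(3.11)] -/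
theorem range_symplecticSatakeTransform_one_eq_twisted (hϖ : Valued.v ϖ = WithZero.exp (-1 : ℤ)) :
    LinearMap.range (symplecticSatakeTransform (n := n) (K := K) hϖ (1 : Rˣ)).toLinearMap =
      symplecticTwistedTarget R n (Nat.card 𝓀[K]) := by
  refine le_antisymm ?_ fun f hf => ?_
  · rintro _ ⟨T, rfl⟩
    exact symplecticSatakeTransform_one_mem_twisted hϖ T
  · obtain ⟨T, hT⟩ := exists_symplecticSatakeTransform_one_eq_of_mem_twisted hϖ f hf
    exact ⟨T, hT⟩

/-- **THE COUNTING SATAKE ISOMORPHISM OF `Sp_{2n}` OVER EVERY COMMUTATIVE RING**: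
`𝒮_1 : ℋ(Sp_{2n}(K), Sp_{2n}(𝒪); R) ≃ₗ[R] 𝒯_R` (injective by the tree's `symplecticSatakeTransform_injective_of_commRing`, onto by
the triangular induction). [cite: ZhuIntegralSatake2020, §1.4] [cite: TreumannVenkatesh2016, §7.2 Theorem (i)]
[cite: GrossSatake1998, (3.10)–(3.11), Prop. 3.6] [cite: Herzig2010, Thm. 1.2] -/
def symplecticCountingSatakeLinearEquiv (hϖ : Valued.v ϖ = WithZero.exp (-1 : ℤ)) :
    heckeAlgebra R (symplecticGroup (Fin n) K) (symplecticInt (Fin n) K) ≃ₗ[R] symplecticTwistedTarget R n (Nat.card 𝓀[K]) :=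
  LinearEquiv.ofBijective
    ((symplecticSatakeTransform hϖ (1 : Rˣ)).toLinearMap.codRestrict (symplecticTwistedTarget R n (Nat.card 𝓀[K]))
      fun T => symplecticSatakeTransform_one_mem_twisted hϖ T)
    ⟨fun T T' h => symplecticSatakeTransform_injective_of_commRing hϖ 1 (congrArg Subtype.val h),
      fun f => by
        obtain ⟨T, hT⟩ := exists_symplecticSatakeTransform_one_eq_of_mem_twisted hϖ f.1 f.2
        exact ⟨T, Subtype.ext hT⟩⟩

/-- The counting isomorphism is the counting transform. [cite: TreumannVenkatesh2016, §7.2] -/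
@[simp] theorem symplecticCountingSatakeLinearEquiv_apply (hϖ : Valued.v ϖ = WithZero.exp (-1 : ℤ))
    (T : heckeAlgebra R (symplecticGroup (Fin n) K) (symplecticInt (Fin n) K)) :
    ((symplecticCountingSatakeLinearEquiv hϖ T : symplecticTwistedTarget R n (Nat.card 𝓀[K])) : AddMonoidAlgebra R (Fin n → ℤ)) =
      symplecticSatakeTransform hϖ 1 T := rfl

end Surjective

/-! ## §5 `𝒯_R` versus the `W(C_n)`-invariants when `q` is a unit -/

section Compare

/-- **`𝒯_R = monomialTwist(q^{⟨ρ,·⟩})⁻¹ (R[ℤⁿ]^{W(C_n)})` when `(q : R) = b` is a unit**: the twisted relations, imposed from the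
dominant end only, are equivalent to the `W(C_n)`-invariance of `Σ_μ q^{⟨ρ,μ⟩} f_μ x^μ` (the relation at a pair with
`⟨ρ,wμ⟩ > ⟨ρ,μ⟩` is the one at `(w⁻¹, wμ)`). [cite: TreumannVenkatesh2016, §7.2] [cite: CartierCorvallis1979, §IV (4.2)] -/
theorem mem_symplecticTwistedTarget_iff_monomialTwist_mem_weylInvariants (q : Rˣ) {b : ℕ} (hq : (q : R) = b)
    (f : AddMonoidAlgebra R (Fin n → ℤ)) :
    f ∈ symplecticTwistedTarget R n b ↔
      monomialTwist (symplecticSatakeWeight q) f ∈ weylInvariants R (Fin n → ℤ) (symplecticWeylGroup n) := by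
  rw [mem_symplecticTwistedTarget_iff, mem_weylInvariants_symplecticWeylGroup_iff]
  -- `b^{d} = q^{d}` for `d = (r - r').toNat`, `r' ≤ r`
  have hpow : ∀ {r r' : ℤ}, r' ≤ r → ((b : R) ^ (r - r').toNat) * ((q ^ r' : Rˣ) : R) = ((q ^ r : Rˣ) : R) := fun {r r'} h => by
    rw [← hq, ← Units.val_pow_eq_pow_val, ← Units.val_mul, ← zpow_natCast, ← _root_.zpow_add, Int.toNat_of_nonneg (by omega),
      sub_add_cancel]
  constructor
  · intro h ε π μ
    rw [coeff_monomialTwist, coeff_monomialTwist, symplecticSatakeWeight_ofAdd, symplecticSatakeWeight_ofAdd]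
    rcases le_or_gt (symplecticRhoPairing (fun i => (ε i : ℤ) * μ (π i))) (symplecticRhoPairing μ) with hle | hlt
    · rw [h μ ε π hle, ← hpow hle]; ring
    · have h' := h (fun i => (ε i : ℤ) * μ (π i)) (fun j => ε (π.symm j)) π.symm (by rw [signedPerm_inv_apply]; exact hlt.le)
      rw [signedPerm_inv_apply] at h'
      rw [h', ← hpow hlt.le]; ring
  · intro h μ ε π hle
    have h' := h ε π μ
    rw [coeff_monomialTwist, coeff_monomialTwist, symplecticSatakeWeight_ofAdd, symplecticSatakeWeight_ofAdd, ← hpow hle] at h'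
    refine (Units.mul_right_inj (q ^ symplecticRhoPairing (fun i => (ε i : ℤ) * μ (π i)))).1 ?_
    rw [h']; ring

variable {K : Type*} [Field K] [Valued K ℤᵐ⁰] {ϖ : K} [CompactSpace 𝒪[K]] [Finite 𝓀[K]]

/-- **Compatibility of the two Satake isomorphisms**: `monomialTwist(q^{⟨ρ,·⟩}) ∘ 𝒮_1 = 𝒮_q`, i.e. the counting isomorphism
followed by the twist is Cartier's `symplecticSatakeAlgEquiv` (when `(q : R) = #𝓀` is a unit). [cite: CartierCorvallis1979, §IV (4.2)]
[cite: TreumannVenkatesh2016, §7.2] -/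
theorem monomialTwist_symplecticCountingSatakeLinearEquiv (hϖ : Valued.v ϖ = WithZero.exp (-1 : ℤ)) (q : Rˣ) (hq : (q : R) = Nat.card 𝓀[K])
    (T : heckeAlgebra R (symplecticGroup (Fin n) K) (symplecticInt (Fin n) K)) :
    monomialTwist (symplecticSatakeWeight q)
        ((symplecticCountingSatakeLinearEquiv hϖ T : symplecticTwistedTarget R n (Nat.card 𝓀[K])) : AddMonoidAlgebra R (Fin n → ℤ)) =
      ((symplecticSatakeAlgEquiv hϖ q hq T : weylInvariants R (Fin n → ℤ) (symplecticWeylGroup n)) :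
        AddMonoidAlgebra R (Fin n → ℤ)) := by
  rw [symplecticCountingSatakeLinearEquiv_apply, coe_symplecticSatakeAlgEquiv, symplecticSatakeTransform_eq_monomialTwist_comp hϖ q,
    AlgHom.comp_apply, symplecticSatakeTransform_eq]
  congr 1
  exact congrArg (fun w => (isIwasawaExponent_symplectic hϖ).satakeTransform w T)
    (MonoidHom.ext fun l => by rw [← ofAdd_toAdd l, symplecticSatakeWeight_ofAdd, _root_.one_zpow, Units.val_one, MonoidHom.one_apply]).symm

end Compare

end Literature.NumberTheory.Automorphic.SymplecticCartan

end
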